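import Summits.BirchSwinnertonDyer.Rank1Residual.Additive.X3BranchAlgebraicCountWOfLifting
import Summits.BirchSwinnertonDyer.Rank1Residual.AdditivePotMult.PotMultRamifiedLineKummerEqAt
import HarnessLib

/-!
# X3 on the semistable-twist locus, cell (M) (potentially MULTIPLICATIVE, `e = 2`): the algebraic count
# `hAlgWT` — Greenberg–Vatsal's (16)+(11) for `Sel_{p^∞}(W/ℚ_∞)` at the additive prime — from the
# records `h23 ∧ h414` and the Tate uniformisation records `hT40 ∧ hT41`, lifting displayed; with a
# DATUM-GENERIC form of the count (cell `bsd-addord`, seat `bsd-addord-twist`, strategy = twist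
# transport; the (M) twin of `X3BranchAlgebraicCountW[OfLifting].lean`)

HONEST FRAMING (cell `bsd-addord`, `run/shared/lean/pub/bsd-addord/README.md` §4): the programme's
target of record is the full Birch–Swinnerton-Dyer formula for every `E/ℚ` of analytic rank `≤ 1`;
this file concerns the X3 rows (`E[p]` reducible) of cell (M) of N10 (additive, potentially
multiplicative, `e = 2`; odd `p`). THEOREMS ONLY (no `def`, no named fact, no `sorry`); nothing is
booked by this file — the (M) end state ALSO carries the analytic binder `hGVM` (GV's branch
congruence at a multiplicative prime, NOT in print; `X3BranchMultCongruence*.lean`), which this file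
does not touch. PUBLISHED inputs displayed: `h23` (`datumSelmer_nonPrimitive_invariants`), `h414`
(`Greenberg1999.prop414_noFiniteSubmodule_of_not_dvd_torsionOrder`), `hT40`/`hT41` (Silverman ATAEC
V.5.3 / Cor. V.5.4 Tate uniformisation, records A40/A41); the residual lifting `hlift` (GV p. 28/30)
is displayed in the Literature vocabulary (discharged by `residualEpsilon_surjOn_of_lineEven` /
`…_of_lineRamifiedEven`).

## What

* §1 **`natCard_line_mul_quotSelmer_eq_of_data_of_lifting`** — the count of the sibling files in
  DATUM-GENERIC form: for ANY Greenberg data `Lf` above `p` of ramified ordinary lines whose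
  `p`-torsion plus-part is the even line `Φ₀` (`hplus`) and which satisfy the R-D identity over `ℚ_∞`
  (`hRD`), `#H¹(ℚ_Σ/ℚ_∞, Φ₀)·#U = p^{λ(X(W/ℚ_∞)) + Σδ}` for `X` torsion with `μ = 0` (from `h23`,
  `h414`, `hlift`). The (G-ord) files are the instance `Lf = t(C_v(V))`.
* §2 `exists_data_isRamifiedOrdinaryLine_plus_eq_lineSub_of_mult_twist` — on `W = C • V^{(p*)}` with `V`
  MULTIPLICATIVE at `p`: the twisted TATE datum (tree `exists_isRamifiedOrdinaryLine_shape_of_mult_twist`,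
  mod `hT40`/`hT41`, with its quotient shape "inertia acts through `χ_K`") has `p`-torsion plus-part
  `Φ₀` for every rational line with ramified `χ_K`-twist (the sibling's χ-twisted Serre-line lemma
  `torsionDatum_plus_eq_lineSub_of_chiTwist`).
* §3 **`natCard_line_mul_quotSelmer_eq_of_mult_pStar_twist_of_lifting`**,
  **`X3Branch.algebraicCountWMult_of_facts_of_lifting[_of_field]`** — the (M) count and the displayed
  `hAlgW` of `X3BranchMultCongruenceDescent[EndState].lean` with the torsion binder (R-D over `ℚ_∞` by
  `PotMult.ramifiedLineKummerEqAt`, mod `hT40`/`hT41`).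

References: [GreenbergVatsal2000] §2 (11), (16), pp. 14–15, 26–30, Prop. (2.8), Remark (2.9), Cor. (2.3),
Prop. (2.4); [GreenbergLNM1716] Prop. 4.14, §2 pp. 74–76; [SilvermanATAEC1994] Ch. V Thm. 5.3, Cor. 5.4;
[EmertonPollackWeston2006] §3.1.
-/

set_option autoImplicit false

noncomputable section

open scoped Classical AddSubgroup

namespace Summit.BirchSwinnertonDyer.Rank1Residual.Additive

open NumberField IsDedekindDomain Field WeierstrassCurve
  Literature.NumberTheory.GaloisRepresentations
  Literature.NumberTheory.EllipticCurves
  Literature.NumberTheory.EllipticCurves.GreenbergSelmer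
  Literature.NumberTheory.EllipticCurves.GreenbergVatsal2000
  Literature.NumberTheory.EllipticCurves.EmertonPollackWeston2006
  Literature.NumberTheory.EllipticCurves.Rank1Residual
  Summit.BirchSwinnertonDyer.Rank1Residual.X2
  Summit.BirchSwinnertonDyer.Rank1Residual.X2.GreenbergVatsalTorsion
  Summit.BirchSwinnertonDyer.Rank1Residual.X2.GreenbergVatsalReductionDatum
  Summit.BirchSwinnertonDyer.Rank1Residual.X2.ResidualDevissageLine
  Summit.BirchSwinnertonDyer.Rank1Residual.X1.MuLambda
  Summit.BirchSwinnertonDyer.Rank1Residual.GaloisImage.RamifiedOrdinaryLineTwist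
  Summit.BirchSwinnertonDyer.Rank1Residual.AdditivePotMult
  Summit.BirchSwinnertonDyer.Rank1Residual.AdditivePotMult.RamifiedOrdinaryLinePotMult
  Summit.BirchSwinnertonDyer.Rank1Residual.Additive.TameDescent

/-! ### §1 The count, DATUM-GENERIC -/

section Generic

variable {p : ℕ} [hp : Fact p.Prime] {W : WeierstrassCurve ℚ} [W.IsElliptic] [W.IsGloballyMinimal]

/-- **GV (16)+(11) for `Sel_{p^∞}(W/ℚ_∞)`, DATUM-GENERIC.** `W/ℚ` globally minimal, `p` odd, `κ`
cyclotomic with topological generator `γ`; Greenberg data `Lf` above `p` of RAMIFIED ORDINARY LINES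
satisfying the R-D identity over `ℚ_∞` (`hRD`) and whose `p`-torsion plus-part is the rational line
`Φ₀` (`hplus`); `Φ₀` EVEN with non-trivial `Γ_ℚ`-action; `Σ₀ ∌ p` finite with the bad places `≠ p`
inside; the residual lifting `hlift`; `D` ANY `Λ`-dual datum of `Sel_{p^∞}(W/ℚ_∞)` with `D.X` f.g.
TORSION and `μ = 0`. THEN `#H¹(ℚ_Σ/ℚ_∞, Φ₀)·#U(W[p]/Φ₀) = p^{λ(D.X) + Σ_{v∈Σ₀} δ_v(W)}`, GRANTED the
records `h23`, `h414`. Chain as in `X3BranchAlgebraicCountW.lean` §1.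
[cite: GreenbergVatsal2000, §2 pp. 26–30 (display (16), (11)), Prop. (2.8), Remark (2.9), Cor. (2.3), Prop. (2.4)]
[cite: GreenbergLNM1716, Prop. 4.14] -/
theorem natCard_line_mul_quotSelmer_eq_of_data_of_lifting
    (h23 : datumSelmer_nonPrimitive_invariants)
    (h414 : Greenberg1999.prop414_noFiniteSubmodule_of_not_dvd_torsionOrder) (hp2 : p ≠ 2)
    {κ : ZpExtension ℚ p} {γ : absoluteGaloisGroup ℚ} (hκ : κ.IsCyclotomic) (hγ : κ.IsTopGenerator γ)
    (Lf : Data ℚ (W.geomPrimaryTorsion p) p)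
    (hLf : ∀ (v : HeightOneSpectrum (𝓞 ℚ)) (hv : ((p : ℕ) : 𝓞 ℚ) ∈ v.asIdeal),
      IsRamifiedOrdinaryLine W p (Lf v hv))
    (hRD : ∀ (v : HeightOneSpectrum (𝓞 ℚ)) (hv : ((p : ℕ) : 𝓞 ℚ) ∈ v.asIdeal),
      (Lf v hv).greenbergKer κ.kerSubgroup = W.localKerOver p κ.kerSubgroup (v.adicCompletion ℚ))
    (S₀ : Finset (HeightOneSpectrum (𝓞 ℚ))) (hS₀ : ∀ v ∈ S₀, ((p : ℕ) : 𝓞 ℚ) ∉ v.asIdeal)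
    (hS : ∀ v : HeightOneSpectrum (𝓞 ℚ), v ∉ S₀ → ((p : ℕ) : 𝓞 ℚ) ∉ v.asIdeal →
      W.HasGoodReductionAt v)
    {Φ₀ : AddSubgroup (W.geomTorsion (p : ℤ))} (hΦ : IsRationalLine W p Φ₀)
    (heven : LineEven W p Φ₀)
    (hnt : ∃ (σ : absoluteGaloisGroup ℚ) (P : W.geomTorsion (p : ℤ)), P ∈ Φ₀ ∧ σ • P ≠ P)
    (hplus : ∀ (v : HeightOneSpectrum (𝓞 ℚ)) (hv : ((p : ℕ) : 𝓞 ℚ) ∈ v.asIdeal),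
      (torsionDatum (Lf v hv) p).plus = (lineSub Φ₀ hΦ).toAddSubgroup)
    (hlift : ∀ s ∈ residualQuotSelmer W p κ S₀ Φ₀ hΦ, ∃ x ∈ residualTorsionH1 W p κ S₀,
      residualEpsilon W p κ Φ₀ hΦ x = s)
    (D : W.SelmerDualData κ γ) [Module.Finite (IwasawaAlgebra p) D.X] (hDt : D.IsTorsion)
    (hμ : D.mu = 0) :
    Nat.card (residualLineH1 W p κ S₀ Φ₀ hΦ) * Nat.card (residualQuotSelmer W p κ S₀ Φ₀ hΦ) =
      p ^ (lambdaInvariant p D.X + ∑ v ∈ S₀, delta W p v) := by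
  have hS₀' : ∀ v ∈ (↑S₀ : Set (HeightOneSpectrum (𝓞 ℚ))), ((p : ℕ) : 𝓞 ℚ) ∉ v.asIdeal :=
    fun v hv ↦ hS₀ v (Finset.mem_coe.mp hv)
  have hS' : ∀ v : HeightOneSpectrum (𝓞 ℚ), v ∉ (↑S₀ : Set (HeightOneSpectrum (𝓞 ℚ))) →
      ((p : ℕ) : 𝓞 ℚ) ∉ v.asIdeal → W.HasGoodReductionAt v :=
    fun v hv hpv ↦ hS v (fun h ↦ hv (Finset.mem_coe.2 h)) hpv
  -- no rational `p`-torsion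
  have htors : ¬ p ∣ W.torsionOrder := not_dvd_torsionOrder_of_line_of_nontrivial hΦ hp2 heven hnt
  -- `Sel = S_A`, `Sel^{Σ₀} = S^{Σ₀}_A`
  have hSel := selmerInfty_eq_datumSelmerInfty W p κ hp2 hκ Lf hRD
  have hNP := nonPrimitiveSelmerInfty_eq_datumSelmerInfty W p κ
    (↑S₀ : Set (HeightOneSpectrum (𝓞 ℚ))) hp2 hκ Lf hRD hS₀'
  -- the record in classical currency on X2's non-primitive dual
  set DS := X2.NonPrimitiveSelmerDual.nonPrimitiveDualData W κ
    (↑S₀ : Set (HeightOneSpectrum (𝓞 ℚ))) hγ with hDS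
  obtain ⟨hfg, ht, hμS, hlamS, hdiv⟩ :=
    record_consequences_of_eq h23 hp2 hκ hγ Lf hLf htors S₀ hS₀ hSel hNP D hDt DS
  haveI := hfg
  have hμS' : muInvariant p DS.X = 0 := by rw [hμS]; exact hμ
  -- no finite submodule (Greenberg 4.14) ⟹ `#Sel^{Σ₀}[p] = p^{λ(X^{Σ₀})} = p^{λ(X) + Σδ}`
  have hnf := nonPrimitive_noFiniteSubmodule_of_prop414 h414 htors hκ hγ D hDt DS hdiv
  have hcount := natCard_torsionBy_nonPrimitiveSelmerInfty_eq_pow_lambdaInvariant κ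
    (↑S₀ : Set (HeightOneSpectrum (𝓞 ℚ))) DS ht hμS' hnf
  rw [hlamS, natCard_torsionBy_nonPrimitiveSelmerInfty_eq_of_greenbergKer_eq W p κ
    (↑S₀ : Set (HeightOneSpectrum (𝓞 ℚ))) hp2 hκ Lf hRD hS₀' hS'] at hcount
  -- GV Prop. (2.8) / Remark (2.9): `#S^{Σ₀}_{W[p]} = #(S^{Σ₀}_{W[p^∞]} ⊓ H¹[p]) · 1`
  haveI := finite_fixedPoints_of_not_dvd_torsionOrder W κ htors
  have h28 := GreenbergVatsalTorsionRamified.natCard_gvSelmer_torsion_curve_of_invariants_eq_bot_of_finite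
    W p κ.kerSubgroup Lf (↑S₀ : Set (HeightOneSpectrum (𝓞 ℚ))) hS'
    (fun v hv ↦ fun c hc' ↦ (hLf v hv).divisible hc')
    (RamifiedOrdinaryLineQuotientModelFree.data_gr_invariants_eq_zero_of_isRamifiedOrdinaryLine hp2 κ
      Lf hLf)
  rw [natCard_torsionBy_fixedPoints_eq_one W κ htors, mul_one] at h28
  -- display (16) at the twisted datum
  obtain ⟨c, hcc⟩ := exists_isComplexConjugation (Rat.castHom ℝ)
  have hdev := X3TwistedDatum.natCard_gvSelmer_torsion_eq_mul_of_plus_eq_line hΦ hp2 heven Lf hplus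
    (↑S₀ : Set (HeightOneSpectrum (𝓞 ℚ))) hS' κ.kerSubgroup
    (ResidualDevissageLine.mem_kerSubgroup_of_isComplexConjugation κ hcc) hcc
    hlift
  -- assembly
  change Nat.card (GreenbergVatsal2000.unramifiedOutside κ.kerSubgroup (lineSub Φ₀ hΦ).Sub p
      (↑S₀ : Set (HeightOneSpectrum (𝓞 ℚ)))) *
    Nat.card (ResidualDevissageSelmer.quotSelmer κ.kerSubgroup (lineSub Φ₀ hΦ).Quot p
      (↑S₀ : Set (HeightOneSpectrum (𝓞 ℚ)))) = _
  rw [← hdev, h28]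
  rw [gvSelmerInfty] at hcount
  exact hcount

end Generic

/-! ### §2 The twisted TATE datum of `W = C • V^{(p*)}`, `V` multiplicative: `p`-torsion plus-part `Φ₀` -/

section MultDatum

variable (V : WeierstrassCurve ℚ) [V.IsElliptic] [V.IsGloballyMinimal]
  (K : Type) [Field K] [NumberField K]
  (h2 : Module.finrank ℚ K = 2) {θ : K} (hθ : θ ∉ Set.range (algebraMap ℚ K)) (p : ℕ) [hp : Fact p.Prime]
  (hc : θ ^ 2 = algebraMap ℚ K ((-1) ^ (p / 2) * p))
  {W : WeierstrassCurve ℚ} [W.IsElliptic] {C : VariableChange ℚ}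
  (hC : C • V.quadraticTwist ((-1 : ℚ) ^ (p / 2) * p) = W)

include h2 hθ hc hC in
/-- **Greenberg data of RAMIFIED ORDINARY LINES with `p`-torsion plus-part `Φ₀`** on
`W = C • V^{(p*)}`, `V` MULTIPLICATIVE at the odd `p`, for every rational line `Φ₀` with ramified
`χ_K`-twist — mod the Tate uniformisation records `hT40`/`hT41`: at the place above `p` take the
twisted Tate line (`exists_isRamifiedOrdinaryLine_shape_of_mult_twist`), on whose quotient inertia
acts through `χ_K`, and apply the χ-twisted Serre-line lemma
(`torsionDatum_plus_eq_lineSub_of_chiTwist`). [cite: GreenbergVatsal2000, §2 pp. 14–15 and p. 28]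
[cite: SilvermanATAEC1994, Ch. V Thm. 5.3, Cor. 5.4] [cite: EmertonPollackWeston2006, §3.1 (eq:ordes)] -/
theorem exists_data_isRamifiedOrdinaryLine_plus_eq_lineSub_of_mult_twist [(galRange (K := ℚ) K).Normal]
    (hT40 : Silverman1994_thmV53_tateUniformisation.{0})
    (hT41 : Silverman1994_thmV53_corV54_tateUniformisation.{0}) (hp2 : p ≠ 2) (hmult : Mult V p)
    {Φ₀ : AddSubgroup (geomTorsion W (p : ℤ))} (hΦ : IsRationalLine W p Φ₀)
    (hram : ¬ ∀ w : HeightOneSpectrum (𝓞 ℚ), ((p : ℕ) : 𝓞 ℚ) ∈ w.asIdeal →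
      ∀ 𝔓 ∈ w.primesAbove, ∀ σ ∈ 𝔓.inertia (absoluteGaloisGroup ℚ), ∀ P ∈ Φ₀,
        σ • P = (if σ ∈ galRange (K := ℚ) K then P else -P)) :
    ∃ Lf : Data ℚ (W.geomPrimaryTorsion p) p,
      (∀ (v : HeightOneSpectrum (𝓞 ℚ)) (hv : ((p : ℕ) : 𝓞 ℚ) ∈ v.asIdeal),
        IsRamifiedOrdinaryLine W p (Lf v hv)) ∧
      ∀ (v : HeightOneSpectrum (𝓞 ℚ)) (hv : ((p : ℕ) : 𝓞 ℚ) ∈ v.asIdeal),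
        (torsionDatum (Lf v hv) p).plus = (lineSub Φ₀ hΦ).toAddSubgroup := by
  have h : ∀ (v : HeightOneSpectrum (𝓞 ℚ)) (hv : ((p : ℕ) : 𝓞 ℚ) ∈ v.asIdeal),
      ∃ L : LocalDatum ℚ (W.geomPrimaryTorsion p) v, IsRamifiedOrdinaryLine W p L ∧
        (torsionDatum L p).plus = (lineSub Φ₀ hΦ).toAddSubgroup := by
    intro v hv
    obtain ⟨L, hL, hshape, -⟩ := exists_isRamifiedOrdinaryLine_shape_of_mult_twist V K h2 hθ hc p hC
      hT40 hT41 hp2 hmult hv (valuation_pStar p v hv)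
    refine ⟨L, hL, torsionDatum_plus_eq_lineSub_of_chiTwist hΦ K hram hv L ?_
      (RamifiedLineUnique.natCard_plus_inf_torsionBy_eq hL)⟩
    intro x hx m
    obtain ⟨σ, hσ, rfl⟩ := Subgroup.mem_map.1 hx
    show absGaloisRestrict ℚ (v.adicCompletion ℚ) σ • m -
        (if absGaloisRestrict ℚ (v.adicCompletion ℚ) σ ∈ galRange (K := ℚ) K then m else -m) ∈ L.plus
    by_cases hg : absGaloisRestrict ℚ (v.adicCompletion ℚ) σ ∈ galRange (K := ℚ) K
    · rw [if_pos hg]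
      exact (hshape σ hσ).1 hg m
    · rw [if_neg hg, sub_neg_eq_add]
      exact (hshape σ hσ).2 hg m
  choose Lf hLf using h
  exact ⟨Lf, fun v hv ↦ (hLf v hv).1, fun v hv ↦ (hLf v hv).2⟩

end MultDatum

/-! ### §3 The (M) count and the displayed `hAlgWT` for the (M) cell -/

section Mult

variable {p : ℕ} [hp : Fact p.Prime] {W : WeierstrassCurve ℚ} [W.IsElliptic] [W.IsGloballyMinimal]

/-- **GV (16)+(11) for `Sel_{p^∞}(W/ℚ_∞)` on the (M) cell.** `p` odd; `V` globally minimal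
MULTIPLICATIVE at `p` with `C • V^{(p*)} = W`, `W` potentially multiplicative at `p` (`hpm`, for the
R-D identity `PotMult.ramifiedLineKummerEqAt`); `K` quadratic with `θ² = p*`, `θ ∉ ℚ`; `Σ₀`, `Φ₀`
(rational, EVEN, non-trivial action, ramified `χ_K`-twist), `hlift`, `κ`, `γ`, `D` as in §1. THEN
`#H¹(ℚ_Σ/ℚ_∞, Φ₀)·#U = p^{λ(D.X) + Σδ}` — GRANTED `h23`, `h414`, `hT40`, `hT41`.
[cite: GreenbergVatsal2000, §2 pp. 14–15, 26–30] [cite: GreenbergLNM1716, Prop. 4.14, §2 pp. 74–76]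
[cite: SilvermanATAEC1994, Ch. V Thm. 5.3, Cor. 5.4] -/
theorem natCard_line_mul_quotSelmer_eq_of_mult_pStar_twist_of_lifting
    (h23 : datumSelmer_nonPrimitive_invariants)
    (h414 : Greenberg1999.prop414_noFiniteSubmodule_of_not_dvd_torsionOrder)
    (hT40 : Silverman1994_thmV53_tateUniformisation.{0})
    (hT41 : Silverman1994_thmV53_corV54_tateUniformisation.{0})
    (hp2 : p ≠ 2) (hpm : AdditivePotMult.PotMult W p) (V : WeierstrassCurve ℚ) [V.IsElliptic] [V.IsGloballyMinimal]
    (hmult : Mult V p) {C : VariableChange ℚ} (hC : C • V.quadraticTwist ((-1 : ℚ) ^ (p / 2) * p) = W)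
    (K : Type) [Field K] [NumberField K] [(galRange (K := ℚ) K).Normal]
    (h2 : Module.finrank ℚ K = 2) {θ : K} (hθ : θ ∉ Set.range (algebraMap ℚ K))
    (hc : θ ^ 2 = algebraMap ℚ K ((-1) ^ (p / 2) * p))
    (S₀ : Finset (HeightOneSpectrum (𝓞 ℚ))) (hS₀ : ∀ v ∈ S₀, ((p : ℕ) : 𝓞 ℚ) ∉ v.asIdeal)
    (hS : ∀ v : HeightOneSpectrum (𝓞 ℚ), v ∉ S₀ → ((p : ℕ) : 𝓞 ℚ) ∉ v.asIdeal →
      W.HasGoodReductionAt v)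
    {Φ₀ : AddSubgroup (W.geomTorsion (p : ℤ))} (hΦ : IsRationalLine W p Φ₀)
    (heven : LineEven W p Φ₀)
    (hnt : ∃ (σ : absoluteGaloisGroup ℚ) (P : W.geomTorsion (p : ℤ)), P ∈ Φ₀ ∧ σ • P ≠ P)
    (hram : ¬ ∀ w : HeightOneSpectrum (𝓞 ℚ), ((p : ℕ) : 𝓞 ℚ) ∈ w.asIdeal →
      ∀ 𝔓 ∈ w.primesAbove, ∀ σ ∈ 𝔓.inertia (absoluteGaloisGroup ℚ), ∀ P ∈ Φ₀,
        σ • P = (if σ ∈ galRange (K := ℚ) K then P else -P))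
    {κ : ZpExtension ℚ p} {γ : absoluteGaloisGroup ℚ} (hκ : κ.IsCyclotomic) (hγ : κ.IsTopGenerator γ)
    (hlift : ∀ s ∈ residualQuotSelmer W p κ S₀ Φ₀ hΦ, ∃ x ∈ residualTorsionH1 W p κ S₀,
      residualEpsilon W p κ Φ₀ hΦ x = s)
    (D : W.SelmerDualData κ γ) [Module.Finite (IwasawaAlgebra p) D.X] (hDt : D.IsTorsion)
    (hμ : D.mu = 0) :
    Nat.card (residualLineH1 W p κ S₀ Φ₀ hΦ) * Nat.card (residualQuotSelmer W p κ S₀ Φ₀ hΦ) =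
      p ^ (lambdaInvariant p D.X + ∑ v ∈ S₀, delta W p v) := by
  obtain ⟨Lf, hLf, hplus⟩ := exists_data_isRamifiedOrdinaryLine_plus_eq_lineSub_of_mult_twist V K h2 hθ
    p hc hC hT40 hT41 hp2 hmult hΦ hram
  exact natCard_line_mul_quotSelmer_eq_of_data_of_lifting h23 h414 hp2 hκ hγ Lf hLf
    (fun v hv ↦ AdditivePotMult.PotMult.ramifiedLineKummerEqAt hT40 hT41 hp2 hpm κ hκ v hv (Lf v hv)
      (hLf v hv)) S₀ hS₀ hS hΦ heven hnt hplus hlift D hDt hμ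

/-- **The displayed `hAlgW` of `X3BranchMultCongruenceDescent[EndState].lean` WITH the torsion binder,
for one quadratic `K`, on the (M) cell** — from `h23 ∧ h414 ∧ hT40 ∧ hT41` + the line datum + the
displayed lifting (per `κ`). [cite: GreenbergVatsal2000, §2 (11), (16), pp. 26–30]
[cite: GreenbergLNM1716, Prop. 4.14] [cite: SilvermanATAEC1994, Ch. V Thm. 5.3, Cor. 5.4] -/
theorem X3Branch.algebraicCountWMult_of_facts_of_lifting_of_field
    (h23 : datumSelmer_nonPrimitive_invariants)
    (h414 : Greenberg1999.prop414_noFiniteSubmodule_of_not_dvd_torsionOrder)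
    (hT40 : Silverman1994_thmV53_tateUniformisation.{0})
    (hT41 : Silverman1994_thmV53_corV54_tateUniformisation.{0})
    (hp2 : p ≠ 2) (hpm : AdditivePotMult.PotMult W p) (V : WeierstrassCurve ℚ) [V.IsElliptic] [V.IsGloballyMinimal]
    (hmult : Mult V p) {C : VariableChange ℚ} (hC : C • V.quadraticTwist ((-1 : ℚ) ^ (p / 2) * p) = W)
    (K : Type) [Field K] [NumberField K] [(galRange (K := ℚ) K).Normal]
    (h2 : Module.finrank ℚ K = 2) {θ : K} (hθ : θ ∉ Set.range (algebraMap ℚ K))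
    (hc : θ ^ 2 = algebraMap ℚ K ((-1) ^ (p / 2) * p))
    (S₀ : Finset (HeightOneSpectrum (𝓞 ℚ))) (hS₀ : ∀ v ∈ S₀, ((p : ℕ) : 𝓞 ℚ) ∉ v.asIdeal)
    (hS : ∀ v : HeightOneSpectrum (𝓞 ℚ), v ∉ S₀ → ((p : ℕ) : 𝓞 ℚ) ∉ v.asIdeal →
      W.HasGoodReductionAt v)
    (Φ₀ : AddSubgroup (W.geomTorsion (p : ℤ))) (hΦ : IsRationalLine W p Φ₀)
    (heven : LineEven W p Φ₀)
    (hnt : ∃ (σ : absoluteGaloisGroup ℚ) (P : W.geomTorsion (p : ℤ)), P ∈ Φ₀ ∧ σ • P ≠ P)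
    (hram : ¬ ∀ w : HeightOneSpectrum (𝓞 ℚ), ((p : ℕ) : 𝓞 ℚ) ∈ w.asIdeal →
      ∀ 𝔓 ∈ w.primesAbove, ∀ σ ∈ 𝔓.inertia (absoluteGaloisGroup ℚ), ∀ P ∈ Φ₀,
        σ • P = (if σ ∈ galRange (K := ℚ) K then P else -P))
    (hlift : ∀ (κ : ZpExtension ℚ p), κ.IsCyclotomic →
      ∀ s ∈ residualQuotSelmer W p κ S₀ Φ₀ hΦ, ∃ x ∈ residualTorsionH1 W p κ S₀,
        residualEpsilon W p κ Φ₀ hΦ x = s)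
    {κ : ZpExtension ℚ p} {γ : absoluteGaloisGroup ℚ} (D : W.SelmerDualData κ γ)
    (g : IwasawaAlgebra p) (hκ : κ.IsCyclotomic) (hγ : κ.IsTopGenerator γ) (hDt : D.IsTorsion)
    (hchar : D.charIdeal = Ideal.span {g}) (hμg : HasUnitContent g) :
    p ^ (lam g + ∑ v ∈ S₀, delta W p v) =
      Nat.card (residualLineH1 W p κ S₀ Φ₀ hΦ) * Nat.card (residualQuotSelmer W p κ S₀ Φ₀ hΦ) := by
  haveI : Module.Finite (IwasawaAlgebra p) D.X := D.module_finite_holds hγ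
  have hg0 : g ≠ 0 := X11a.ne_zero_of_hasUnitContent hμg
  have hμ : D.mu = 0 := (mu_eq_zero_iff_hasUnitContent D hDt hchar).mpr hμg
  have hlam : lam g = lambdaInvariant p D.X :=
    X1.ParitySqueeze.lam_generator_eq_lambdaInvariant D.X hDt hg0 hchar
  rw [hlam]
  exact (natCard_line_mul_quotSelmer_eq_of_mult_pStar_twist_of_lifting h23 h414 hT40 hT41 hp2 hpm V
    hmult hC K h2 hθ hc S₀ hS₀ hS hΦ heven hnt hram hκ hγ (hlift κ hκ) D hDt hμ).symm

/-- **The displayed `hAlgW` of `X3BranchMultCongruenceDescent[EndState].lean` WITH the torsion binder,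
`∀ K` reading of "`χ`-twist ramified", on the (M) cell** — from `h23 ∧ h414 ∧ hT40 ∧ hT41` + the line
datum + the displayed lifting. [cite: GreenbergVatsal2000, §2 (11), (16), pp. 26–30]
[cite: GreenbergLNM1716, Prop. 4.14] [cite: SilvermanATAEC1994, Ch. V Thm. 5.3, Cor. 5.4] -/
theorem X3Branch.algebraicCountWMult_of_facts_of_lifting
    (h23 : datumSelmer_nonPrimitive_invariants)
    (h414 : Greenberg1999.prop414_noFiniteSubmodule_of_not_dvd_torsionOrder)
    (hT40 : Silverman1994_thmV53_tateUniformisation.{0})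
    (hT41 : Silverman1994_thmV53_corV54_tateUniformisation.{0})
    (hp2 : p ≠ 2) (hpm : AdditivePotMult.PotMult W p) (V : WeierstrassCurve ℚ) [V.IsElliptic] [V.IsGloballyMinimal]
    (hmult : Mult V p) {C : VariableChange ℚ} (hC : C • V.quadraticTwist ((-1 : ℚ) ^ (p / 2) * p) = W)
    (S₀ : Finset (HeightOneSpectrum (𝓞 ℚ))) (hS₀ : ∀ v ∈ S₀, ((p : ℕ) : 𝓞 ℚ) ∉ v.asIdeal)
    (hS : ∀ v : HeightOneSpectrum (𝓞 ℚ), v ∉ S₀ → ((p : ℕ) : 𝓞 ℚ) ∉ v.asIdeal →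
      W.HasGoodReductionAt v)
    (Φ₀ : AddSubgroup (W.geomTorsion (p : ℤ))) (hΦ : IsRationalLine W p Φ₀)
    (heven : LineEven W p Φ₀)
    (hnt : ∃ (σ : absoluteGaloisGroup ℚ) (P : W.geomTorsion (p : ℤ)), P ∈ Φ₀ ∧ σ • P ≠ P)
    (hram : ∀ (K : Type) [Field K] [NumberField K] [(galRange (K := ℚ) K).Normal],
      Module.finrank ℚ K = 2 → (∃ θ : K, θ ^ 2 = algebraMap ℚ K ((-1) ^ (p / 2) * p)) →
      ¬ ∀ v : HeightOneSpectrum (𝓞 ℚ), ((p : ℕ) : 𝓞 ℚ) ∈ v.asIdeal →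
        ∀ 𝔓 ∈ v.primesAbove, ∀ σ ∈ 𝔓.inertia (absoluteGaloisGroup ℚ), ∀ P ∈ Φ₀,
          σ • P = (if σ ∈ galRange (K := ℚ) K then P else -P))
    (hlift : ∀ (κ : ZpExtension ℚ p), κ.IsCyclotomic →
      ∀ s ∈ residualQuotSelmer W p κ S₀ Φ₀ hΦ, ∃ x ∈ residualTorsionH1 W p κ S₀,
        residualEpsilon W p κ Φ₀ hΦ x = s)
    {κ : ZpExtension ℚ p} {γ : absoluteGaloisGroup ℚ} (D : W.SelmerDualData κ γ)
    (g : IwasawaAlgebra p) (hκ : κ.IsCyclotomic) (hγ : κ.IsTopGenerator γ) (hDt : D.IsTorsion)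
    (hchar : D.charIdeal = Ideal.span {g}) (hμg : HasUnitContent g) :
    p ^ (lam g + ∑ v ∈ S₀, delta W p v) =
      Nat.card (residualLineH1 W p κ S₀ Φ₀ hΦ) * Nat.card (residualQuotSelmer W p κ S₀ Φ₀ hΦ) := by
  obtain ⟨K, _, _, h2, θ, hθ, hc⟩ := exists_numberField_sq_eq_pStar (p := p) hp2
  haveI : IsGalois ℚ K := isGalois_of_finrank_eq_two K h2
  haveI : (galRange (K := ℚ) K).Normal := normal_galRange K h2 (sigmaQ_ne_one K h2 hθ hc)
  exact X3Branch.algebraicCountWMult_of_facts_of_lifting_of_field h23 h414 hT40 hT41 hp2 hpm V hmult hC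
    K h2 hθ hc S₀ hS₀ hS Φ₀ hΦ heven hnt (hram K h2 ⟨θ, hc⟩) hlift D g hκ hγ hDt hchar hμg

end Mult

end Summit.BirchSwinnertonDyer.Rank1Residual.Additive

end
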